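import Literature.Geometry.Riemannian.ChangGurskyYangProofs
import Literature.Geometry.Riemannian.RicciFlowScalarMaximumPrinciple
import HarnessLib

/-!
# Hessian, d'Alembertian and Laplace–Beltrami operator under constant rescaling of the metric

For `c ≠ 0` and `f` of class `C²` at the point: `Hess_{c g} f = Hess_g f` (the Levi-Civita connections agree,
`leviCivita_constSmul`), `□_{c g} f = c⁻¹ □_g f` and `Δ_{c g} f = c⁻¹ Δ_g f`
(`trace_constSmul`). Topping 2006, §1.2.3 ("under `g ↦ λ g` … `Δ ↦ λ⁻¹ Δ`"); O'Neill 1983,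
Ch. 3, Def. 3.50. Used to move Laplacian comparison / barrier statements between the scales
`Ric ≥ -(m-1)` and `Ric ≥ -(m-1)κ²` (Cheeger–Colding 1996, proof of Prop. 6.2: "since the
statement is scale invariant it suffices to assume `R = 1`"). No definitions, no named facts.

## References

* P. Topping, *Lectures on the Ricci flow*, LMS Lecture Note Ser. 325 (2006), §1.2.3. [Topping2006]
* B. O'Neill, *Semi-Riemannian Geometry* (1983), Ch. 3, Def. 3.50. [ONeill1983]
-/

noncomputable section

open Bundle Set Function
open scoped Manifold ContDiff

namespace Literature.Geometry.Riemannian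

open Lorentzian Lorentzian.PseudoRiemannianMetric

variable {E : Type*} [NormedAddCommGroup E] [NormedSpace ℝ E] [FiniteDimensional ℝ E]
  {M : Type*} [TopologicalSpace M] [ChartedSpace E M] [IsManifold 𝓘(ℝ, E) ∞ M]
  (g : PseudoRiemannianMetric 𝓘(ℝ, E) ∞ E (TangentSpace 𝓘(ℝ, E) : M → Type _)) [g.HasLeviCivita]
  (c : ℝ) (hc : c ≠ 0)

/-- **`Hess_{c g} f = Hess_g f`** at a point where `f` is `C²`: the Hessian depends on the
metric only through the Levi-Civita connection, which is scale invariant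
(`leviCivita_constSmul`; both sides evaluate by `hessian_apply_holds`).
[cite: Topping2006, §1.2.3] [cite: ONeill1983, Ch. 3, Def. 3.48] -/
theorem hessian_constSmul [CompleteSpace E] [(g.constSmul c hc).HasLeviCivita] {f : M → ℝ} {x : M}
    (hf : ContMDiffAt 𝓘(ℝ, E) 𝓘(ℝ, ℝ) 2 f x) :
    (g.constSmul c hc).hessian f x = g.hessian f x := by
  have haux : ∀ X Y : Π y : M, TangentSpace 𝓘(ℝ, E) y,
      (g.constSmul c hc).hessianAux f X Y x = g.hessianAux f X Y x := fun X Y ↦ by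
    simp only [hessianAux, leviCivita_constSmul c hc]
  refine LinearMap.ext fun a ↦ LinearMap.ext fun b ↦ ?_
  set X : Π y : M, TangentSpace 𝓘(ℝ, E) y := FiberBundle.extend E a with hX
  set Y : Π y : M, TangentSpace 𝓘(ℝ, E) y := FiberBundle.extend E b with hY
  have hXd : MDiffAt (T% X) x := FiberBundle.mdifferentiableAt_extend ..
  have hYd : MDiffAt (T% Y) x := FiberBundle.mdifferentiableAt_extend ..
  have ha : X x = a := by rw [hX, FiberBundle.extend_apply_self]
  have hb : Y x = b := by rw [hY, FiberBundle.extend_apply_self]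
  rw [← ha, ← hb, (g.constSmul c hc).hessian_apply_holds hf hXd hYd,
    g.hessian_apply_holds hf hXd hYd, haux]

/-- **`□_{c g} f = c⁻¹ □_g f`** (Topping 2006, §1.2.3; O'Neill 1983, Ch. 3, Def. 3.50).
[cite: Topping2006, §1.2.3] -/
theorem dalembertian_constSmul [CompleteSpace E] [(g.constSmul c hc).HasLeviCivita] {f : M → ℝ}
    {x : M} (hf : ContMDiffAt 𝓘(ℝ, E) 𝓘(ℝ, ℝ) 2 f x) :
    (g.constSmul c hc).dalembertian f x = c⁻¹ * g.dalembertian f x := by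
  simp only [dalembertian, hessian_constSmul g c hc hf, trace_constSmul]

/-- **`Δ_{c g} f = c⁻¹ Δ_g f`** for the Laplace–Beltrami operators (`laplaceBeltrami`, each with
its own Levi-Civita instance). [cite: Topping2006, §1.2.3] -/
theorem laplaceBeltrami_constSmul [CompleteSpace E] {f : M → ℝ} {x : M}
    (hf : ContMDiffAt 𝓘(ℝ, E) 𝓘(ℝ, ℝ) 2 f x) :
    (g.constSmul c hc).laplaceBeltrami f x = c⁻¹ * g.laplaceBeltrami f x := by
  haveI : (g.constSmul c hc).HasLeviCivita := HasLeviCivita.constSmul (g := g) c hc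
  rw [laplaceBeltrami_eq_dalembertian, laplaceBeltrami_eq_dalembertian,
    dalembertian_constSmul g c hc hf]

end Literature.Geometry.Riemannian

end
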